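import Summits.BirchSwinnertonDyer.BirchSwinnertonDyer.Theorems.ThetaPartnerAtTwoSignedKatoUpToAtTwoLocalTwoPlusPointsLayer
import Literature.NumberTheory.EllipticCurves.Sprung2012.LocalTowerTraceProofs
import Mathlib.RingTheory.PowerSeries.WeierstrassPreparation
import HarnessLib

/-!
# Route `ThetaPartnerAtTwo` (TP2), crux K3 `SignedKatoDivisibilityUpToAtTwo` (item stmt-BirchSwinnertonDyer-20308),
# line `colemanrat` v4 — THE LOCAL THEORY AT `p = 2`, file 14: **`Ker Col♭` kills the Galois orbit of every EVEN-level point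
# of a Honda system with `a_p = 0`** (the Coleman-kernel half of «`Ker Col♭ ⊆ ann E⁺`», Kobayashi Thm. 6.2 / Prop. 8.18–8.23
# read at `a_p = 0`, every prime), and the Nakayama step «generation modulo `p` + vanishing on generators ⟹ vanishing»

HONEST FRAMING (cell `bsd-wall`, lead `bsd-wall-tp2-p2x` g3): THEOREMS ONLY — no definition, no named fact, no instance, no `sorry`;
pure algebra on Sprung's transcription (`pairingSum`, `IsColemanPair`, `colemanKer`); closes no item; BSD is NOT proved by any of this.

## Why this file (G3-LEAD-v4.md §5 — the one remaining LOCAL statement inside stub (R2) `stub_localRobustPackageTwo`)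

In Sprung's convention `H¹_Iw(T) = Hom(E(K_∞·K_v), ℤ_p)` the clause (Col)+(LocCover) of the localised `2`-robust package wants
the witness `P := 𝓗/ann(E⁺_∞)`, `ι := Col♭`: legitimate iff **`Ker Col♭ ⊆ ann(E⁺)`**. With `a_p = 0` Sprung's coefficient
`u_n = sharpPoly 0 p n` VANISHES for even `n` (`sharpPoly_zero_two_mul`), so a functional `z` with `♭`-Coleman value `0`
(`IsColemanPair κ ι W 0 g c z L♯ 0`) satisfies `ω_{2k} ∣ P_{2k, c_{2k}}(z)` in `Λ = ℤ_p⟦T⟧` — and `P_{n,x}(z) = ∑_{j<pⁿ} z(gʲx)(1+T)ʲ`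
is a polynomial of degree `< pⁿ` while `ω_n` is distinguished of degree `pⁿ`: by the uniqueness of WEIERSTRASS DIVISION
(Mathlib `PowerSeries.IsWeierstrassDivision.eq_zero`) the polynomial is `0`, i.e. **`z(gʲ • c_{2k}) = 0` for all `j`** — `z` kills
the whole `Γ`-orbit of every even-level point (§2–§3; no character theory, no Gauss sums). Since at `a_p = 0` the even-level
points lie in Kobayashi's `E⁺` and GENERATE it modulo `2` (CYC⁺@2 = `SignedEC.stub_plusCyclicLayersTwo_of_honda`, a theorem of
HONDA⁺@2), the Nakayama step of §4 («`A ⊆ ℤ[Γ]·d + p·A` and `z(Γ•d) = 0` ⟹ `z(A) = 0`», via «an additive subgroup `S ≤ ℤ_p` with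
`S ⊆ p•S` is `0`») turns this into `Ker Col♭ ⊆ ann(E⁺(ℚ_{2,n}))` the moment CYC⁺(n) is a theorem. §5 reads it on the
`ℤ₂`-tower points `d` of files 12–13 (`p = 2`, cyclotomic `κ`, every `ι`).

## What is proved
* §1 (`Λ = ℤ_p⟦T⟧`, any `p`) `order_map_mk_toIwasawa_cyclotomicOmega` (`ω_n ≡ T^{pⁿ} mod p`: order `pⁿ`),
  `eq_zero_of_toIwasawa_cyclotomicOmega_dvd_sum` (`ω_n ∣ ∑_{j<pⁿ} C(a_j)(1+T)ʲ ⟹ a_j = 0`, Weierstrass division).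
* §2 (any `K, p, κ, E, ι, W, g, c`) `evalOn_pow_smul_eq_zero_of_isColemanPair_flat_zero`: `IsColemanPair κ ι W 0 g c z L♯ 0 ⟹
  z(gʲ • c (2k)) = 0` (`j < p^{2k}`); `apply_pow_smul_eq_zero_of_isColemanPair_flat_zero` (all `j`, `c (2k)` a layer point);
  `apply_smul_eq_zero_of_isColemanPair_flat_zero` (all `τ ∈ Γ_E`, `g` a local lift of the topological generator);
  `apply_smul_eq_zero_of_mem_colemanKer_flat` (`z ∈ Ker Col♭`).
* §3 `AddSubgroup.eq_bot_of_le_prime_smul` (`S ≤ ℤ_p`, `S ⊆ p•S ⟹ S = ⊥`), `apply_eq_zero_of_generated_mod_prime`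
  (the Nakayama step on a subgroup `A` of local points generated by the orbit of `d` modulo `p`).
* §4 `colemanKer_flat_apply_eq_zero_of_generated_mod_prime` (`Ker Col♭ ⊆ ann(A)` for `A ⊆ ℤ[Γ]c_{2k} + p·A`); (`p = 2`, `W/ℚ`
  globally minimal, `GoodSS W 2`, `a₂ = 0`, cyclotomic `κ`, every `ι`) `exists_plusPoints_colemanKer_flat_two`.

References: [Kobayashi2003] Thm. 6.2, Prop. 8.18–8.23; [Sprung2012] Def. 3.1, 5.9, 7.1, 7.9, p. 1485 («Col♭ = Col⁺ for a_p = 0»);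
[Sprung2017] Cor. 4.4 (`u_{2k} = 0` at `a_p = 0`); [Washington1997] §7.1 Prop. 7.2 (Weierstrass division).
-/

set_option autoImplicit false
-- the Theorems namespace of this sub repeats the summit name by design (D-0017 nested layout)
set_option linter.dupNamespace false

noncomputable section

open scoped Classical

namespace Summit.BirchSwinnertonDyer.BirchSwinnertonDyer.Theorems

namespace SignedKatoOffTwo.LocalTwo

open Polynomial Literature.NumberTheory.EllipticCurves Literature.NumberTheory.GaloisRepresentations
  Literature.NumberTheory.EllipticCurves.ZpExtension Literature.NumberTheory.EllipticCurves.Kobayashi2003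
  Literature.NumberTheory.EllipticCurves.Sprung2017 Literature.NumberTheory.EllipticCurves.Sprung2012

universe u

/-! ## §1 `ω_n`-divisibility of a polynomial of degree `< pⁿ` in `Λ = ℤ_p⟦T⟧` forces it to vanish -/

section Omega

variable {p : ℕ} [hp : Fact p.Prime]

/-- `toIwasawa p (cyclotomicOmega p n)` is the power series of the polynomial `(X+1)^{pⁿ} − 1 ∈ ℤ_p[X]`. [folklore] -/
theorem toIwasawa_cyclotomicOmega_eq_coe (n : ℕ) :
    toIwasawa p (cyclotomicOmega p n) = (((X + 1) ^ p ^ n - 1 : ℤ_[p][X]) : PowerSeries ℤ_[p]) := by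
  rw [toIwasawa, cyclotomicOmega, RingHom.comp_apply, Polynomial.coe_mapRingHom]
  simp only [Polynomial.map_sub, Polynomial.map_pow, Polynomial.map_add, Polynomial.map_X, Polynomial.map_one]
  rfl

/-- The coefficients of `ω_n` over `ℤ_p`: `C(pⁿ, i)` for `i ≥ 1`, and `0` in degree `0`. [folklore] -/
theorem coeff_toIwasawa_cyclotomicOmega (n i : ℕ) :
    PowerSeries.coeff i (toIwasawa p (cyclotomicOmega p n)) = (((p ^ n).choose i : ℕ) : ℤ_[p]) - if i = 0 then 1 else 0 := by
  rw [toIwasawa_cyclotomicOmega_eq_coe, Polynomial.coeff_coe, Polynomial.coeff_sub, Polynomial.coeff_X_add_one_pow,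
    Polynomial.coeff_one]

/-- **`ω_n ≡ T^{pⁿ} (mod p)`**: the image of `ω_n = (1+T)^{pⁿ} − 1` in `(ℤ_p/p)⟦T⟧` has order `pⁿ` (the binomial coefficients
`C(pⁿ, i)`, `0 < i < pⁿ`, are divisible by `p`) — `ω_n` is a distinguished polynomial of degree `pⁿ`.
[cite: Washington1997, §7.1 (distinguished polynomials)] -/
theorem order_map_mk_toIwasawa_cyclotomicOmega (n : ℕ) :
    ((toIwasawa p (cyclotomicOmega p n)).map (Ideal.Quotient.mk (IsLocalRing.maximalIdeal ℤ_[p]))).order = (p ^ n : ℕ) := by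
  rw [PowerSeries.order_eq_nat]
  constructor
  · rw [PowerSeries.coeff_map, coeff_toIwasawa_cyclotomicOmega, if_neg (pow_ne_zero n hp.out.ne_zero), sub_zero, Nat.choose_self,
      Nat.cast_one, map_one]
    exact one_ne_zero
  · intro i hi
    rw [PowerSeries.coeff_map, coeff_toIwasawa_cyclotomicOmega]
    by_cases hi0 : i = 0
    · subst hi0; simp
    · rw [if_neg hi0, sub_zero, map_natCast]
      obtain ⟨m, hm⟩ := hp.out.dvd_choose_pow hi0 hi.ne
      rw [hm, Nat.cast_mul]
      have hp0 : ((p : ℕ) : ℤ_[p] ⧸ IsLocalRing.maximalIdeal ℤ_[p]) = 0 := by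
        rw [← map_natCast (Ideal.Quotient.mk (IsLocalRing.maximalIdeal ℤ_[p])), Ideal.Quotient.eq_zero_iff_mem,
          PadicInt.maximalIdeal_eq_span_p]
        exact Ideal.mem_span_singleton_self _
      rw [hp0, zero_mul]

/-- The image of `ω_n` in the residue field is non-zero (its coefficient in degree `pⁿ` is `1`). [folklore] -/
theorem map_residue_toIwasawa_cyclotomicOmega_ne_zero (n : ℕ) :
    (toIwasawa p (cyclotomicOmega p n)).map (IsLocalRing.residue ℤ_[p]) ≠ 0 := by
  intro h
  have h1 := congrArg (PowerSeries.coeff (p ^ n)) h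
  rw [PowerSeries.coeff_map, coeff_toIwasawa_cyclotomicOmega, if_neg (pow_ne_zero n hp.out.ne_zero), sub_zero, Nat.choose_self,
    Nat.cast_one, map_one, map_zero] at h1
  exact one_ne_zero h1

/-- **A polynomial `∑_{j<pⁿ} a_j (1+T)ʲ` of degree `< pⁿ` divisible by `ω_n` in `Λ = ℤ_p⟦T⟧` is ZERO: all `a_j = 0`.**
Uniqueness of Weierstrass division by the distinguished polynomial `ω_n` (Mathlib `PowerSeries.IsWeierstrassDivision.eq_zero`),
then the change of variable `T ↦ T − 1`. [cite: Washington1997, §7.1 Prop. 7.2] -/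
theorem eq_zero_of_toIwasawa_cyclotomicOmega_dvd_sum (n : ℕ) (a : ℕ → ℤ_[p])
    (h : toIwasawa p (cyclotomicOmega p n) ∣
      ∑ j ∈ Finset.range (p ^ n), PowerSeries.C (a j) * (1 + PowerSeries.X) ^ j) :
    ∀ j, j < p ^ n → a j = 0 := by
  obtain ⟨q, hq⟩ := h
  set r : ℤ_[p][X] := ∑ j ∈ Finset.range (p ^ n), Polynomial.C (a j) * (X + 1) ^ j with hr
  have hrcoe : ((r : ℤ_[p][X]) : PowerSeries ℤ_[p]) = ∑ j ∈ Finset.range (p ^ n), PowerSeries.C (a j) * (1 + PowerSeries.X) ^ j := by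
    rw [hr, ← Polynomial.coeToPowerSeries.ringHom_apply, map_sum]
    refine Finset.sum_congr rfl fun j _ ↦ ?_
    rw [map_mul, map_pow, map_add, map_one, Polynomial.coeToPowerSeries.ringHom_apply, Polynomial.coeToPowerSeries.ringHom_apply,
      Polynomial.coe_C, Polynomial.coe_X, add_comm]
  -- degree of `r` is `< pⁿ`
  have hp1 : 1 ≤ p ^ n := Nat.one_le_pow _ _ hp.out.pos
  have hnat : r.natDegree ≤ p ^ n - 1 := by
    rw [hr]
    refine Polynomial.natDegree_sum_le_of_forall_le _ _ fun j hj ↦ ?_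
    rw [Finset.mem_range] at hj
    calc (Polynomial.C (a j) * (X + 1) ^ j).natDegree ≤ ((X + 1 : ℤ_[p][X]) ^ j).natDegree :=
          Polynomial.natDegree_C_mul_le _ _
      _ ≤ j * (X + 1 : ℤ_[p][X]).natDegree := Polynomial.natDegree_pow_le
      _ ≤ j * 1 := by
          refine Nat.mul_le_mul_left j ?_
          rw [← Polynomial.C_1, Polynomial.natDegree_X_add_C]
      _ ≤ p ^ n - 1 := by omega
  have hrdeg : (-r).degree < ((p ^ n : ℕ) : WithBot ℕ) := by
    rw [Polynomial.degree_neg]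
    refine lt_of_le_of_lt Polynomial.degree_le_natDegree ?_
    exact_mod_cast (show r.natDegree < p ^ n by omega)
  -- Weierstrass division `0 = ω_n · q + (−r)`
  have hW : PowerSeries.IsWeierstrassDivision 0 (toIwasawa p (cyclotomicOmega p n)) q (-r) := by
    refine ⟨?_, ?_⟩
    · rw [order_map_mk_toIwasawa_cyclotomicOmega, ENat.toNat_coe]
      exact hrdeg
    · rw [Polynomial.coe_neg, hrcoe, ← hq, add_neg_cancel]
  have hr0 : r = 0 := by
    have h2 := (PowerSeries.IsWeierstrassDivision.eq_zero (map_residue_toIwasawa_cyclotomicOmega_ne_zero (p := p) n) hW).2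
    rwa [neg_eq_zero] at h2
  -- change of variable `X ↦ X − 1`
  have hcomp : r.comp (X - 1) = ∑ j ∈ Finset.range (p ^ n), Polynomial.C (a j) * X ^ j := by
    rw [hr, Polynomial.sum_comp]
    refine Finset.sum_congr rfl fun j _ ↦ ?_
    rw [Polynomial.mul_comp, Polynomial.C_comp, Polynomial.pow_comp, Polynomial.add_comp, Polynomial.X_comp,
      Polynomial.one_comp, sub_add_cancel]
  intro j hj
  have hc : (r.comp (X - 1)).coeff j = a j := by
    rw [hcomp, Polynomial.finsetSum_coeff]
    simp_rw [Polynomial.coeff_C_mul_X_pow]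
    rw [Finset.sum_ite_eq (Finset.range (p ^ n)) j, if_pos (Finset.mem_range.mpr hj)]
  rw [← hc, hr0, Polynomial.zero_comp, Polynomial.coeff_zero]

end Omega

/-! ## §2 `Ker Col♭` kills the orbit of every even-level point (Honda systems with `a_p = 0`, every prime) -/

section Kernel

variable {K : Type u} [Field K] {p : ℕ} [hp : Fact p.Prime] (κ : ZpExtension K p)
variable {E : Type u} [Field E] [Algebra K E] (ι : AlgebraicClosure K →ₐ[K] AlgebraicClosure E)
variable (W : WeierstrassCurve K)

omit hp in
/-- `u_{2k} = 0` at `a_p = 0` (`u_{n+2} = a_p u_{n+1} − Φ·u_n`, `u_0 = 0`). [cite: Sprung2017, §4 Cor. 4.4 (the case a_p = 0)] -/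
theorem sharpPoly_zero_of_even (k : ℕ) : sharpPoly 0 p (2 * k) = 0 := by
  induction k with
  | zero => rfl
  | succ k ih =>
    rw [show 2 * (k + 1) = 2 * k + 2 by ring, sharpPoly, sprungSeq_add_two]
    change Polynomial.C (0 : ℤ) * _ - _ * sharpPoly 0 p (2 * k) = 0
    rw [ih, Polynomial.C_0, zero_mul, mul_zero, sub_zero]

variable {κ ι W}

/-- **`Ker Col♭` kills the `g`-orbit of every even-level point** (`a_p = 0`, every prime): if `z` has `♭`-Coleman value `0`
for the system `c` (`IsColemanPair κ ι W 0 g c z L♯ 0`), then `z(gʲ • c_{2k}) = 0` for all `j < p^{2k}` — at even levels Sprung's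
congruence reads `ω_{2k} ∣ P_{2k,c_{2k}}(z)` (`u_{2k} = 0`), and §1 forces the polynomial `P_{2k}(z)` to vanish.
[cite: Sprung2012, Def. 3.1, Def. 5.9, Def. 7.1 (pp. 1489–1500)] [cite: Kobayashi2003, Thm. 6.2, Prop. 8.18–8.23] -/
theorem evalOn_pow_smul_eq_zero_of_isColemanPair_flat_zero {g : Field.absoluteGaloisGroup E} {c : ℕ → localPoints W E}
    {z : localTowerPointsOfEmb κ ι W →+ ℤ_[p]} {Lsharp : IwasawaAlgebra p}
    (h : IsColemanPair κ ι W 0 g c z Lsharp 0) (k j : ℕ) (hj : j < p ^ (2 * k)) :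
    evalOn W (localTowerPointsOfEmb κ ι W) z (g ^ j • c (2 * k)) = 0 := by
  have hn := h (2 * k)
  rw [sharpPoly_zero_of_even, map_zero, zero_mul, mul_zero, add_zero, add_zero, pairingSum_def] at hn
  exact eq_zero_of_toIwasawa_cyclotomicOmega_dvd_sum (2 * k)
    (fun i ↦ evalOn W (localTowerPointsOfEmb κ ι W) z (g ^ i • c (2 * k))) hn j hj

/-- The same for ALL exponents `j`, when `c_{2k}` is a point of the `2k`-th layer (`g^{p^{2k}}` fixes it).
[cite: Sprung2012, Def. 3.1, Def. 5.9 (pp. 1489–1495)] [cite: Kobayashi2003, Thm. 6.2] -/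
theorem apply_pow_smul_eq_zero_of_isColemanPair_flat_zero {g : Field.absoluteGaloisGroup E}
    (hg : κ.IsTopGenerator (resGalOfEmb ι g)) {c : ℕ → localPoints W E}
    (hc : ∀ n, c n ∈ localLayerPointsOfEmb κ ι W n) {z : localTowerPointsOfEmb κ ι W →+ ℤ_[p]} {Lsharp : IwasawaAlgebra p}
    (h : IsColemanPair κ ι W 0 g c z Lsharp 0) (k j : ℕ) :
    z ⟨g ^ j • c (2 * k), smul_mem_localTowerPointsOfEmb κ ι W _
      (localLayerPointsOfEmb_le_localTowerPointsOfEmb κ ι W _ (hc (2 * k)))⟩ = 0 := by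
  have hpk : 0 < p ^ (2 * k) := pow_pos hp.out.pos _
  -- reduce `j` modulo `p^{2k}`
  have hper : g ^ j • c (2 * k) = g ^ (j % p ^ (2 * k)) • c (2 * k) := by
    conv_lhs => rw [← Nat.mod_add_div j (p ^ (2 * k)), pow_add, mul_smul,
      pow_mul_smul_of_mem_localLayerPointsOfEmb κ ι W hg (hc (2 * k)) (j / p ^ (2 * k))]
  have h0 := evalOn_pow_smul_eq_zero_of_isColemanPair_flat_zero h k (j % p ^ (2 * k)) (Nat.mod_lt j hpk)
  rw [← hper, evalOn_of_mem] at h0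
  exact h0

/-- Every `τ ∈ Γ_E` acts on a layer-`n` point as a power of the local generator lift `g` (`Gal(K_n·K_v/K_v)` is generated
by the image of `g`). [folklore] -/
theorem exists_smul_eq_pow_smul_of_mem_localLayerPointsOfEmb {g : Field.absoluteGaloisGroup E}
    (hg : κ.IsTopGenerator (resGalOfEmb ι g)) {n : ℕ} {y : localPoints W E} (hy : y ∈ localLayerPointsOfEmb κ ι W n)
    (τ : Field.absoluteGaloisGroup E) : ∃ j : ℕ, τ • y = g ^ j • y := by
  set e : ℕ := (PadicInt.toZModPow n (κ (resGalOfEmb ι τ)).toAdd).val with he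
  refine ⟨e, ?_⟩
  have hmem : τ⁻¹ * g ^ e ∈ localLayerSubgroupOfEmb κ ι n := by
    have hpow : (κ (resGalOfEmb ι (g ^ e))).toAdd = (e : ℤ_[p]) := by
      rw [map_pow]
      change (κ.toContinuousMonoidHom (resGalOfEmb ι g ^ e)).toAdd = _
      rw [map_pow, toAdd_pow]
      change e • (κ (resGalOfEmb ι g)).toAdd = _
      rw [hg, toAdd_ofAdd, nsmul_eq_mul, mul_one]
    rw [mem_localLayerSubgroupOfEmb_iff, map_mul, map_inv]
    change (p : ℤ_[p]) ^ n ∣ (κ.toContinuousMonoidHom ((resGalOfEmb ι τ)⁻¹ * resGalOfEmb ι (g ^ e))).toAdd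
    rw [map_mul, map_inv, toAdd_mul, toAdd_inv]
    change (p : ℤ_[p]) ^ n ∣ -(κ (resGalOfEmb ι τ)).toAdd + (κ (resGalOfEmb ι (g ^ e))).toAdd
    rw [hpow, ← Ideal.mem_span_singleton, ← PadicInt.ker_toZModPow, RingHom.mem_ker, map_add, map_neg, map_natCast, he,
      ZMod.natCast_zmod_val, neg_add_cancel]
  have hfix := (mem_localLayerPointsOfEmb_iff κ ι W n y).mp hy _ hmem
  rw [mul_smul] at hfix
  calc τ • y = τ • (τ⁻¹ • (g ^ e • y)) := by rw [hfix]
    _ = g ^ e • y := smul_inv_smul τ _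

/-- **`Ker Col♭` kills the whole `Γ_E`-orbit of every even-level point** of a system `c` with `a_p = 0` (for a functional with
`♭`-Coleman value `0`). [cite: Sprung2012, Def. 5.9, Def. 7.1, Def. 7.9 (pp. 1495–1503)] [cite: Kobayashi2003, Thm. 6.2, Prop. 8.18–8.23] -/
theorem apply_smul_eq_zero_of_isColemanPair_flat_zero {g : Field.absoluteGaloisGroup E}
    (hg : κ.IsTopGenerator (resGalOfEmb ι g)) {c : ℕ → localPoints W E}
    (hc : ∀ n, c n ∈ localLayerPointsOfEmb κ ι W n) {z : localTowerPointsOfEmb κ ι W →+ ℤ_[p]} {Lsharp : IwasawaAlgebra p}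
    (h : IsColemanPair κ ι W 0 g c z Lsharp 0) (k : ℕ) (τ : Field.absoluteGaloisGroup E) :
    z ⟨τ • c (2 * k), smul_mem_localTowerPointsOfEmb κ ι W _
      (localLayerPointsOfEmb_le_localTowerPointsOfEmb κ ι W _ (hc (2 * k)))⟩ = 0 := by
  obtain ⟨j, hj⟩ := exists_smul_eq_pow_smul_of_mem_localLayerPointsOfEmb hg (hc (2 * k)) τ
  have h0 := apply_pow_smul_eq_zero_of_isColemanPair_flat_zero hg hc h k j
  convert h0 using 2
  exact Subtype.ext hj

/-- **`z ∈ Ker Col♭ ⟹ z` kills the `Γ_E`-orbit of every even-level point** (`a_p = 0`; `Ker Col♭ = colemanKer … .flat`).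
[cite: Sprung2012, Def. 7.9 (p. 1503)] [cite: Kobayashi2003, Thm. 6.2] -/
theorem apply_smul_eq_zero_of_mem_colemanKer_flat {g : Field.absoluteGaloisGroup E}
    (hg : κ.IsTopGenerator (resGalOfEmb ι g)) {c : ℕ → localPoints W E}
    (hc : ∀ n, c n ∈ localLayerPointsOfEmb κ ι W n) {z : localTowerPointsOfEmb κ ι W →+ ℤ_[p]}
    (hz : z ∈ colemanKer κ ι W 0 g c .flat) (k : ℕ) (τ : Field.absoluteGaloisGroup E) :
    z ⟨τ • c (2 * k), smul_mem_localTowerPointsOfEmb κ ι W _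
      (localLayerPointsOfEmb_le_localTowerPointsOfEmb κ ι W _ (hc (2 * k)))⟩ = 0 := by
  obtain ⟨Lsharp, Lflat, hpair, hflat⟩ := hz
  change Lflat = 0 at hflat
  subst hflat
  exact apply_smul_eq_zero_of_isColemanPair_flat_zero hg hc hpair k τ

end Kernel

/-! ## §3 The Nakayama step: generation modulo `p` + vanishing on the generator's orbit ⟹ vanishing -/

section Nakayama

variable {p : ℕ} [hp : Fact p.Prime]

/-- **An additive subgroup `S ≤ ℤ_p` with `S ⊆ p•S` is zero** (a non-zero element of minimal valuation would be `p` times an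
element of smaller valuation). [folklore] -/
theorem AddSubgroup.eq_bot_of_le_prime_mul (S : AddSubgroup ℤ_[p]) (h : ∀ x ∈ S, ∃ y ∈ S, x = (p : ℤ_[p]) * y) : S = ⊥ := by
  classical
  rw [AddSubgroup.eq_bot_iff_forall]
  by_contra hne
  obtain ⟨x₀, hx₀⟩ := not_forall.mp hne
  obtain ⟨hx₀S, hx₀0⟩ := Classical.not_imp.mp hx₀
  have hex : ∃ m : ℕ, ∃ x ∈ S, x ≠ 0 ∧ x.valuation = m := ⟨x₀.valuation, x₀, hx₀S, hx₀0, rfl⟩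
  obtain ⟨x, hxS, hx0, hxm⟩ := Nat.find_spec hex
  obtain ⟨y, hyS, hxy⟩ := h x hxS
  have hy0 : y ≠ 0 := by rintro rfl; exact hx0 (by rw [hxy, mul_zero])
  have hval : x.valuation = 1 + y.valuation := by
    rw [hxy, PadicInt.valuation_mul (NeZero.ne _) hy0, PadicInt.valuation_p]
  have hmin := Nat.find_min' hex ⟨y, hyS, hy0, rfl⟩
  rw [← hxm, hval] at hmin
  omega

/-- **The Nakayama step.** Let `A ≤ A'` be subgroups of an additive group with a `Γ`-action by group automorphisms... concretely:
`A, A'` subgroups of the local points, `z : A' →+ ℤ_p`, `A ≤ A'`, and suppose every `P ∈ A` is `B + p•R` with `B` in the subgroup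
generated by the `Γ_E`-orbit of a point `d` and `R ∈ A` (generation of `A` by `d` modulo `p` — the shape of CYC⁺@2), and `z` kills
the orbit of `d`. Then `z` kills `A`. [folklore] -/
theorem apply_eq_zero_of_generated_mod_prime {K : Type u} [Field K] {E : Type u} [Field E] [Algebra K E] {W : WeierstrassCurve K}
    {A A' : AddSubgroup (localPoints W E)} (hAA' : A ≤ A') (z : A' →+ ℤ_[p]) {d : localPoints W E}
    (hgen : ∀ P ∈ A, ∃ B ∈ AddSubgroup.closure (Set.range fun σ : Field.absoluteGaloisGroup E ↦ σ • d), ∃ R ∈ A, P = B + p • R)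
    (hd : ∀ (σ : Field.absoluteGaloisGroup E) (hσ : σ • d ∈ A'), z ⟨σ • d, hσ⟩ = 0)
    (horb : ∀ σ : Field.absoluteGaloisGroup E, σ • d ∈ A') :
    ∀ (P : localPoints W E) (hP : P ∈ A), z ⟨P, hAA' hP⟩ = 0 := by
  -- the image `S = z(A)` satisfies `S ⊆ p S`
  set S : AddSubgroup ℤ_[p] := (A.addSubgroupOf A').map z with hS
  have hcl : ∀ B ∈ AddSubgroup.closure (Set.range fun σ : Field.absoluteGaloisGroup E ↦ σ • d), ∃ hB : B ∈ A', z ⟨B, hB⟩ = 0 := by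
    intro B hB
    induction hB using AddSubgroup.closure_induction with
    | mem x hx =>
      obtain ⟨σ, rfl⟩ := hx
      exact ⟨horb σ, hd σ (horb σ)⟩
    | zero => exact ⟨A'.zero_mem, by rw [show (⟨0, A'.zero_mem⟩ : A') = 0 from rfl, map_zero]⟩
    | add x y _ _ hx hy =>
      obtain ⟨hx', hzx⟩ := hx
      obtain ⟨hy', hzy⟩ := hy
      refine ⟨A'.add_mem hx' hy', ?_⟩
      have : (⟨x + y, A'.add_mem hx' hy'⟩ : A') = ⟨x, hx'⟩ + ⟨y, hy'⟩ := rfl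
      rw [this, map_add, hzx, hzy, add_zero]
    | neg x _ hx =>
      obtain ⟨hx', hzx⟩ := hx
      refine ⟨A'.neg_mem hx', ?_⟩
      have : (⟨-x, A'.neg_mem hx'⟩ : A') = -⟨x, hx'⟩ := rfl
      rw [this, map_neg, hzx, neg_zero]
  have hSp : ∀ x ∈ S, ∃ y ∈ S, x = (p : ℤ_[p]) * y := by
    rintro x ⟨⟨P, hP'⟩, hPA, rfl⟩
    rw [SetLike.mem_coe, AddSubgroup.mem_addSubgroupOf] at hPA
    change P ∈ A at hPA
    obtain ⟨B, hB, R, hR, hPBR⟩ := hgen P hPA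
    obtain ⟨hB', hzB⟩ := hcl B hB
    refine ⟨z ⟨R, hAA' hR⟩, ⟨⟨R, hAA' hR⟩, by rw [SetLike.mem_coe, AddSubgroup.mem_addSubgroupOf]; exact hR, rfl⟩, ?_⟩
    have : (⟨P, hP'⟩ : A') = ⟨B, hB'⟩ + p • ⟨R, hAA' hR⟩ := Subtype.ext (by simpa using hPBR)
    rw [this, map_add, map_nsmul, hzB, zero_add, nsmul_eq_mul]
  have hS0 := AddSubgroup.eq_bot_of_le_prime_mul S hSp
  intro P hP
  have hmem : z ⟨P, hAA' hP⟩ ∈ S := ⟨⟨P, hAA' hP⟩, by rw [SetLike.mem_coe, AddSubgroup.mem_addSubgroupOf]; exact hP, rfl⟩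
  rw [hS0] at hmem
  exact (AddSubgroup.mem_bot).mp hmem

end Nakayama

/-! ## §4 Assembly: `Ker Col♭ ⊆ ann(A)` for every subgroup `A` generated modulo `p` by an even-level point; the `p = 2` points -/

section Assembly

variable {K : Type u} [Field K] {p : ℕ} [hp : Fact p.Prime] {κ : ZpExtension K p}
variable {E : Type u} [Field E] [Algebra K E] {ι : AlgebraicClosure K →ₐ[K] AlgebraicClosure E}
variable {W : WeierstrassCurve K}

/-- **`Ker Col♭ ⊆ ann(A)`** for every subgroup `A ≤ E(K_∞·K_v)` GENERATED MODULO `p` BY THE ORBIT OF AN EVEN-LEVEL POINT `c_{2k}` of a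
system with `a_p = 0` (`A ⊆ ℤ[Γ]·c_{2k} + p·A` — the shape of CYC⁺@2 `SignedEC.stub_plusCyclicLayersTwo_of_honda` for Kobayashi's
`E⁺(ℚ_{2,n})`): every `z ∈ Ker Col♭` vanishes on `A`. With `A = E⁺(K_n·K_v)` this is Kobayashi's «`ker Col⁺ = H¹_+`» (Thm. 6.2,
Prop. 8.18–8.23) at `a_p = 0` in Sprung's convention. [cite: Kobayashi2003, Thm. 6.2 (p. 11), Prop. 8.18–8.23] [cite: Sprung2012, Def. 7.9, p. 1485] -/
theorem colemanKer_flat_apply_eq_zero_of_generated_mod_prime {g : Field.absoluteGaloisGroup E}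
    (hg : κ.IsTopGenerator (resGalOfEmb ι g)) {c : ℕ → localPoints W E} (hc : ∀ n, c n ∈ localLayerPointsOfEmb κ ι W n)
    {z : localTowerPointsOfEmb κ ι W →+ ℤ_[p]} (hz : z ∈ colemanKer κ ι W 0 g c .flat)
    {A : AddSubgroup (localPoints W E)} (hA : A ≤ localTowerPointsOfEmb κ ι W) (k : ℕ)
    (hcyc : ∀ P ∈ A, ∃ B ∈ AddSubgroup.closure (Set.range fun σ : Field.absoluteGaloisGroup E ↦ σ • c (2 * k)),
      ∃ R ∈ A, P = B + p • R) :
    ∀ (P : localPoints W E) (hP : P ∈ A), z ⟨P, hA hP⟩ = 0 :=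
  apply_eq_zero_of_generated_mod_prime hA z hcyc
    (fun σ _ ↦ apply_smul_eq_zero_of_mem_colemanKer_flat hg hc hz k σ)
    (fun _ ↦ smul_mem_localTowerPointsOfEmb κ ι W _ (localLayerPointsOfEmb_le_localTowerPointsOfEmb κ ι W _ (hc (2 * k))))

end Assembly

section Two

open Literature.NumberTheory.EllipticCurves.Rank1Residual

/-- **The `ℤ₂`-tower points at `2` and `Ker Col♭`.** For `W/ℚ` globally minimal with `GoodSS W 2`, `a₂(W) = 0`, the cyclotomic `κ` and
every `ι : ℚ̄ → ℚ̄₂`: the points `d` of file 13 (`plusPointsLayer_two_clauses`: (L), (TR) `Tr_{m+2/m+1} d_{m+2} = −d_m`, (NONDIV)) — a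
Honda system with `a_p = 0` in Sprung's sense — have the additional property that for every local lift `g` of the topological generator,
**every `z ∈ Ker Col♭` (`Sprung2012.colemanKer κ ι W 0 g d .flat`) kills `τ • d_{2k}` for all `τ ∈ Γ_{ℚ₂}` and all `k`** (§2), hence
(§4) every subgroup generated modulo `2` by the orbit of some `d_{2k}` — Kobayashi's `E⁺(ℚ_{2,n})` once CYC⁺(n) is a theorem.
[cite: Kobayashi2003, Thm. 6.2, §8.4–8.6] [cite: Sprung2012, Thm. 2.2 (2′), Def. 7.9] -/
theorem exists_plusPoints_colemanKer_flat_two (W : WeierstrassCurve ℚ) [W.IsElliptic] [W.IsGloballyMinimal]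
    (hss : GoodSS W 2) (ha : W.frobeniusTrace 2 = 0) (κ : ZpExtension ℚ 2) (hκ : κ.IsCyclotomic)
    (ι : AlgebraicClosure ℚ →ₐ[ℚ] AlgebraicClosure ℚ_[2]) :
    ∃ d : ℕ → localPoints W ℚ_[2],
      (∀ m, d m ∈ localLayerPointsOfEmb κ ι W m) ∧
      (∀ m, localTraceOfEmb κ ι W (m + 1) (m + 2) (d (m + 2)) = -d m) ∧
      (∀ b ∈ localLayerPointsOfEmb κ ι W 0, d 0 ≠ 2 • b) ∧
      (∀ g : Field.absoluteGaloisGroup ℚ_[2], κ.IsTopGenerator (resGalOfEmb ι g) →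
        ∀ z ∈ colemanKer κ ι W 0 g d .flat, ∀ (k : ℕ) (τ : Field.absoluteGaloisGroup ℚ_[2])
          (hτ : τ • d (2 * k) ∈ localTowerPointsOfEmb κ ι W), z ⟨τ • d (2 * k), hτ⟩ = 0) := by
  obtain ⟨d, hL, hTR, hND⟩ := plusPointsLayer_two_clauses W hss ha κ hκ ι
  exact ⟨d, hL, hTR, hND, fun g hg z hz k τ _ ↦ apply_smul_eq_zero_of_mem_colemanKer_flat hg hL hz k τ⟩

end Two



end SignedKatoOffTwo.LocalTwo

end Summit.BirchSwinnertonDyer.BirchSwinnertonDyer.Theorems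

end
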